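import Summits.SmoothPoincare4.SmoothPoincare4.Theses.SymplecticOrigami
import Summits.SmoothPoincare4.SmoothPoincare4.Theorems.SymplecticOrigamiSchsplitCerf
import Summits.SmoothPoincare4.SmoothPoincare4.Theorems.SymplecticOrigamiOrigamiRung

/-!
# SmoothPoincare4 / SymplecticOrigami — the glue item `OrigamiRungGlue`

Settles item stmt-SmoothPoincare4-16708 (support of route SymplecticOrigami, rev 16):

`(ContactRepresentative → GromovRecognitionRelEnd → CerfGammaFour) ∧
 (McDuffWendlAffinePair → CerfGammaFour → SymplecticChernPackage → SymplecticBettiParity → OrigamiRung)`.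

Pure glue over the route's two LANDED reductions:

* conjunct 1 (Γ₄ = 0 from contact topology) is
  `Theorems.SchsplitCerf.ContactIsotopyGromovCone.CerfGammaFour_of`
  (Theorems/SymplecticOrigamiSchsplitCerf.lean: symplectic cone of a positive contactomorphism,
  Gromov recognition rel end, radial straightening, Cerf's Lemme 2 + two-disc gluing uniqueness);
* conjunct 2 (the origami rung from named facts) is
  `Theorems.OrigamiRung.PairRigidityEndgame.OrigamiRung_of`
  (Theorems/SymplecticOrigamiOrigamiRung.lean, line pair-rigidity-endgame), whose Literature-typed
  hypotheses `canonicalClass_sq_and_adjunction_of_symplectic_four` and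
  `even_one_add_bOne_add_bPlus_of_symplectic_four` are the route items `SymplecticChernPackage` and
  `SymplecticBettiParity` by definitional unfolding.

No named fact is taken as a hypothesis; nothing else is used.
-/

namespace Summit.SmoothPoincare4.SmoothPoincare4.Theses.SymplecticOrigami
open scoped BigOperators Topology Manifold Classical MeasureTheory ProbabilityTheory Matrix InnerProductSpace ComplexConjugate ContinuousMap ContDiff in
open Filter Set Function TopologicalSpace MeasureTheory in
open Literature.SPC4 in
/-- **Record of the dropped route item `OrigamiRungGlue`** = stmt-SmoothPoincare4-16708 (ledger signature verbatim; NOT a route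
item): route SymplecticOrigami replaced `OrigamiRungGlue` (stmt-16658 → stmt-16708, 2026-08-16T20:46Z) and later dropped the stmt-16708 decl from the route file. The declaration `Summit.SmoothPoincare4.SmoothPoincare4.Theses.SymplecticOrigami.OrigamiRungGlue`
therefore no longer exists in the route file and this accepted module stopped elaborating (stale olean;
buildfix lane 2026-08-19). Re-created here under its original name so the result keeps building; the
statement of every previously accepted declaration in this file is unchanged. -/
def OrigamiRungGlue : Prop :=
  (ContactRepresentative → GromovRecognitionRelEnd → CerfGammaFour) ∧ (McDuffWendlAffinePair → CerfGammaFour → SymplecticChernPackage → SymplecticBettiParity → OrigamiRung)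
end Summit.SmoothPoincare4.SmoothPoincare4.Theses.SymplecticOrigami



namespace Summit.SmoothPoincare4.SmoothPoincare4.Theorems

open Summit.SmoothPoincare4.SmoothPoincare4.Theses.SymplecticOrigami

/-- The route item `SymplecticChernPackage` is literally the tree's named fact
`canonicalClass_sq_and_adjunction_of_symplectic_four`. -/
theorem symplecticChernPackage_iff_canonicalClass :
    Summit.SmoothPoincare4.SmoothPoincare4.Theses.SymplecticOrigami.SymplecticChernPackage ↔
      Literature.Geometry.Symplectic.canonicalClass_sq_and_adjunction_of_symplectic_four :=
  Iff.rfl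

/-- The route item `SymplecticBettiParity` is literally the tree's named fact
`even_one_add_bOne_add_bPlus_of_symplectic_four`. -/
theorem symplecticBettiParity_iff_even :
    Summit.SmoothPoincare4.SmoothPoincare4.Theses.SymplecticOrigami.SymplecticBettiParity ↔
      Literature.Geometry.Symplectic.even_one_add_bOne_add_bPlus_of_symplectic_four :=
  Iff.rfl

/-- Settles stmt-SmoothPoincare4-16708: the glue item `OrigamiRungGlue` of route SymplecticOrigami,
the conjunction of the two landed reductions `ContactIsotopyGromovCone.CerfGammaFour_of`
(Γ₄ = 0 from Eliashberg's contact representative and Gromov recognition rel end) and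
`PairRigidityEndgame.OrigamiRung_of` (the origami rung from McDuff–Wendl, Γ₄ = 0, the Chern
package and Betti parity).  Proof: unfold and pair the two landed theorems. [folklore] -/
theorem OrigamiRungGlue_proof :
    Summit.SmoothPoincare4.SmoothPoincare4.Theses.SymplecticOrigami.OrigamiRungGlue := by
  unfold OrigamiRungGlue
  refine ⟨fun hCR hGr => ?_, fun hMW hC hK hPar => ?_⟩
  · exact SchsplitCerf.ContactIsotopyGromovCone.CerfGammaFour_of hCR hGr
  · exact OrigamiRung.PairRigidityEndgame.OrigamiRung_of hMW hC
      (symplecticChernPackage_iff_canonicalClass.mp hK) (symplecticBettiParity_iff_even.mp hPar)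

end Summit.SmoothPoincare4.SmoothPoincare4.Theorems
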